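import Summits.HodgeConjecture.HodgeConjecture.Theorems.F0D6CmCurveBodyOpK2   -- ★ previous part of the same Lines workfile `D6CmCurveBody` (size-lint split ×6)
import HarnessLib

/-!
# `F0D6CmCurveBodyS2Probe` — ★ RE-HOME of `Lines/D6CmCurveBody.lean`, PART 4 of 6 (size-lint split; cut at a top-level declaration boundary).

See PART 1 `Theorems/F0D6CmCurveBodyHonest.lean` for the full re-home header and the original module docstring (verbatim there). Namespaces KEPT
(re-opened below exactly as they stand at the cut, with their `open` lines); code bytes = the workfile՚s, docstrings included; options preamble repeated from PART 1.
HC_CM is proved only modulo the 7 printed citations (2 remaining: hLiu418 = stmt-HodgeConjecture-24832, h413 = stmt-HodgeConjecture-24833) until rung 0 closes; a re-home is count-neutral. -/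

noncomputable section

open scoped TensorProduct NumberField
open NumberField IsDedekindDomain Filter
open Literature.NumberTheory.GaloisRepresentations
open Literature.NumberTheory.Automorphic
open Literature.NumberTheory.Automorphic.Liu2021.AppendixC
open scoped TensorProduct Matrix NumberField Kronecker ComplexOrder
open NumberField NumberField.InfinitePlace IsDedekindDomain
open Summit.HodgeConjecture.CorCM.Model Summit.HodgeConjecture.CorCM.Model.HComp Summit.HodgeConjecture.CorCM.HComp
open Literature.AlgebraicGeometry.Motives (CMType)
open Literature.AlgebraicGeometry.ShimuraVarieties.UnitaryCanonicalModel
open Literature.NumberTheory.Automorphic Literature.NumberTheory.Automorphic.UnitaryGroup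
open Literature.NumberTheory.Automorphic.IdeleClassGroup Literature.NumberTheory.Automorphic.Liu2021 Literature.NumberTheory.Automorphic.Liu2021.AppendixC
open Literature.NumberTheory.GaloisRepresentations Literature.RepresentationTheory.Liu2021 Literature.RepresentationTheory.HarrisKudlaSweet1996
open Literature.AlgebraicGeometry.Liu2021 (IsAdmissibleElement)
open Literature.NumberTheory.Weil1964 Literature.NumberTheory.GelbartRogawski1991 Literature.NumberTheory.GelbartRogawski1991.UnitaryDualPair Literature.NumberTheory.GelbartRogawski1991.UnitaryDualPair.WeilCoinv
open Literature.NumberTheory.GelbartRogawski1991.UnitaryDualPair.LocalSplitting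
open Literature.NumberTheory.Automorphic.Liu2021.Def411WeilCarriersDoubling
open Literature.NumberTheory.Automorphic.Liu2021.Def411WeilCarriers (TW JW JW_eq isSymm_TW isUnit_det_TW Rep Eps epsOf Chi rhoVAtLine)


/-!
# d6 S2′-BODY PROBE (HOME-only; A-plan2 (g11) PICK 2026-08-29T22:17:44Z) — GENERIC PART

`S2′ = stub_d6_cmIsotypicQuotient` (probe v11 449e3d37 :786 `S2primeShape`) from THREE NAMED HYPOTHESES, each the exact statement its
producer must deliver, and a REAL composition for rows 7 + 8 + 9 (eigen class, `y ≠ 0`, `y ∈ span(block)`):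

* (H1) `BlockShape C ℓ X ι ρW` — **the DH2c ADAPTOR** (producer: A-p09 (g13) «`f′(ω⋆)^K` is a simple Hecke module» over ★ DH2 toolkit
  p746346/p746778/p747286/p747590 + (G6) p747989 + S1/S1c, and the (ii)/(R-split) chain ★ p747213/p747717/(B-link)/p747990/p747685
  for the commutative-reduced full-degree algebra on the block): from «the block is non-zero», a level `K`, a quasi-idempotent `u₀`
  of `A_K` (the ω⋆-block projector made honest, ★ `HeckeImageProjector`) with INJECTIVE level-`K` transport
  `(toTower K ∘ ᵗV_ℓ(ū₀)) ⊗ 1` (K below the `levelCompat` threshold + ★ (J1a) `dualMap_rationalTateModuleMap_toImage_injective`) whose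
  range lies in the `ℚ̄_ℓ`-span of the block (★ (J1a) `range = eigenspace` + (G6) «block = isotypic part» + S1), `0 < dim Im u₀`, and a
  commutative reduced `ℚ`-subalgebra `R₀ ⊆ End⁰(Im u₀)` with `finrank ℚ R₀ = 2 dim (Im u₀)` ((R-split)(b)).
* (H2) `CMQuotientShape E` — **the CM simple quotient factor** (producer: ★ p745894
  `exists_quasiIdempotent_image_isSimple_numberField_of_comm_isReduced` + G-ros for `IsCMField` + the RESIDUAL (R2) «the simple factor
  is a QUOTIENT of `Im u₀` COMPATIBLE with `toImage`» which p745894 does not export): for ANY abelian variety `A/E`, quasi-idempotent `u₀`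
  and `R₀` as above: `u`, `N ≠ 0`, `u ≫ u = N • u`, a morphism `ψ : Im u₀ ⟶ Im u` with `toImage u₀ ≫ ψ = toImage u` and `ᵗV_ℓ(ψ) ⊗ 1`
  injective (every `ℓ`), a CM number field `M` and `j : M →+* End⁰(Im u)` with `[M:ℚ] = 2 dim (Im u)`.
* (H3) `EigenClassShape E ℓ` — **a non-zero `χ`-eigen dual Tate class** (producer: ★ `TateModuleOfCMSemisimple.exists_basis_baseChange_…_ringHom`
  / ★ `TateModuleOfCMEigenlineCharacter`; RESIDUAL (E1) if the dual/eigen packaging is not by name): for ANY `B/E`, `i : M →+* End⁰(B)` of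
  full degree and `χ : M →+* ℚ̄_ℓ`, some `f ≠ 0` in `ℚ̄_ℓ ⊗ (V_ℓ B)^∨` with `ᵗV_ℓ^ℚ(i m) ⊗ 1 f = χ(m) f`.

THEOREM `s2prime_conclusion_of_shapes`: (H1) ∧ (H2) ∧ (H3) ⟹ the GENERIC S2′ conclusion for `(C, ℓ, X, ι, ρW)` (token-shape of `S2primeShape`՚s
tail with `sec42DataGS ↦ C`, `etaleHeckeDatumGS ↦ X`, `ω⋆_lab ↦ ρW`).  The instantiation at the registered binders is Part B (by paste over v11).
Exposed residuals (≤ 3): (R2) quotient-compatibility of p745894՚s factor; (E1) non-zero eigen DUAL class packaging; (K-inj) «`K` may be shrunk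
below the levelCompat threshold keeping the block value non-zero» (inside H1՚s producer).  HC_CM is proved only modulo the 7 printed citations
until rung 0 closes; nothing here is filed.
-/

set_option autoImplicit false

noncomputable section

open CategoryTheory NumberField
open scoped TensorProduct
open Literature.AlgebraicGeometry.Motives
open Literature.AlgebraicGeometry.Motives.AbelianVariety (rationalTateModuleMap rationalTateAction image toImage)

namespace Literature.NumberTheory.Automorphic.Liu2021.AppendixC.S2primeProbe

open Summit.HodgeConjecture.CorCM.HypLiu418.S2prime (BlockShape')

variable {F E : Type} [Field F] [NumberField F] [IsTotallyReal F] [Field E] [NumberField E] [Algebra F E]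
  [IsTotallyComplex E] [Algebra.IsQuadraticExtension F E]
variable {P5 : PropC5Data F E} {isotropicAt : ℕ → Prop}

/-! ## The three hypothesis SHAPES -/

/-- **(H2) CM simple quotient factor** (generic over abelian varieties over `E`): ★ p745894 + residual (R2) + G-ros. -/
def CMQuotientShape (E : Type) [Field E] [NumberField E] : Prop :=
  ∀ (ℓ : ℕ) [Fact ℓ.Prime] (A : AbelianVariety E) (u₀ : A ⟶ A) (a₀ : ℕ), a₀ ≠ 0 → u₀ ≫ u₀ = a₀ • u₀ → 0 < (image u₀).dim →
    ∀ (R₀ : Subalgebra ℚ (image u₀).endAlgebra), (∀ x ∈ R₀, ∀ y ∈ R₀, x * y = y * x) → IsReduced R₀ →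
      Module.finrank ℚ R₀ = 2 * (image u₀).dim →
      ∃ (u : A ⟶ A) (N : ℕ), N ≠ 0 ∧ u ≫ u = N • u ∧
        ∃ (ψ : image u₀ ⟶ image u), toImage u₀ ≫ ψ = toImage u ∧
          Function.Injective (((rationalTateModuleMap ℓ ψ).dualMap).baseChange (AlgebraicClosure ℚ_[ℓ])) ∧
          ∃ (M : Type) (_ : Field M) (_ : NumberField M) (_ : IsCMField M) (j : M →+* (image u).endAlgebra),
            Function.Bijective j ∧ Module.finrank ℚ M = 2 * (image u).dim

/-- **(H3) a non-zero `χ`-eigen dual Tate class** for a full-degree rational CM structure (generic). -/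
def EigenClassShape (E : Type) [Field E] [NumberField E] (ℓ : ℕ) [Fact ℓ.Prime] : Prop :=
  ∀ (B : AbelianVariety E) (M : Type) [Field M] [NumberField M] (i : M →+* B.endAlgebra),
    Module.finrank ℚ M = 2 * B.dim → ∀ χ : M →+* AlgebraicClosure ℚ_[ℓ],
      ∃ f : AlgebraicClosure ℚ_[ℓ] ⊗[ℚ_[ℓ]] Module.Dual ℚ_[ℓ] (B.rationalTateModule ℓ), f ≠ 0 ∧
        ∀ m : M, ((rationalTateAction B ℓ (i m)).dualMap).baseChange (AlgebraicClosure ℚ_[ℓ]) f = χ m • f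

variable (C : Sec42Data P5 isotropicAt) (ℓ : ℕ) [Fact ℓ.Prime] (X : C.EtaleHeckeDatum ℓ)
  (ι : ℂ ≃+* AlgebraicClosure ℚ_[ℓ]) {W : Type} [AddCommGroup W] [Module ℂ W] (ρW : Representation ℂ C.G W)

/-- **(H1) the DH2c ADAPTOR**: the ω⋆-block projector `u₀` at a small level `K`, injective transport into `ℚ̄_ℓ ⊗ H¹_ét(A_∞)` with
range inside the span of the block, and the commutative reduced full-degree algebra on `Im u₀`. -/
def BlockShape : Prop :=
  (∃ f ∈ X.omegaHom ι ρW, ∃ w : W, f w ≠ 0) →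
    ∃ (K : C5.SmallLevel C.S.K₀) (u₀ : C.A K ⟶ C.A K) (a₀ : ℕ), a₀ ≠ 0 ∧ u₀ ≫ u₀ = a₀ • u₀ ∧ 0 < (image u₀).dim ∧
      Function.Injective
        ((C.toTower ℓ K ∘ₗ (rationalTateModuleMap ℓ (toImage u₀)).dualMap).baseChange (AlgebraicClosure ℚ_[ℓ])) ∧
      (∀ f₀ : AlgebraicClosure ℚ_[ℓ] ⊗[ℚ_[ℓ]] Module.Dual ℚ_[ℓ] ((image u₀).rationalTateModule ℓ),
        ((C.toTower ℓ K ∘ₗ (rationalTateModuleMap ℓ (toImage u₀)).dualMap).baseChange (AlgebraicClosure ℚ_[ℓ])) f₀ ∈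
          Submodule.span (AlgebraicClosure ℚ_[ℓ]) {y | ∃ f ∈ X.omegaHom ι ρW, ∃ w : W, f w = y}) ∧
      ∃ (R₀ : Subalgebra ℚ (image u₀).endAlgebra), (∀ x ∈ R₀, ∀ y ∈ R₀, x * y = y * x) ∧ IsReduced R₀ ∧
        Module.finrank ℚ R₀ = 2 * (image u₀).dim

/-! ## The composition (rows 7 + 8 + 9) -/

/-- transport along a composite `toImage u₀ ≫ ψ = toImage u` factors through the `u₀`-transport. -/
theorem transport_comp_eq {K : C5.SmallLevel C.S.K₀} {u₀ u : C.A K ⟶ C.A K} (ψ : image u₀ ⟶ image u)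
    (hψ : toImage u₀ ≫ ψ = toImage u)
    (f : AlgebraicClosure ℚ_[ℓ] ⊗[ℚ_[ℓ]] Module.Dual ℚ_[ℓ] ((image u).rationalTateModule ℓ)) :
    ((C.toTower ℓ K ∘ₗ (rationalTateModuleMap ℓ (toImage u)).dualMap).baseChange (AlgebraicClosure ℚ_[ℓ])) f =
      ((C.toTower ℓ K ∘ₗ (rationalTateModuleMap ℓ (toImage u₀)).dualMap).baseChange (AlgebraicClosure ℚ_[ℓ]))
        ((((rationalTateModuleMap ℓ ψ).dualMap).baseChange (AlgebraicClosure ℚ_[ℓ])) f) := by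
  have hcomp : C.toTower ℓ K ∘ₗ (rationalTateModuleMap ℓ (toImage u)).dualMap =
      (C.toTower ℓ K ∘ₗ (rationalTateModuleMap ℓ (toImage u₀)).dualMap) ∘ₗ (rationalTateModuleMap ℓ ψ).dualMap := by
    rw [← hψ, AbelianVariety.rationalTateModuleMap_comp, ← LinearMap.dualMap_comp_dualMap, LinearMap.comp_assoc]
  rw [hcomp, LinearMap.baseChange_comp, LinearMap.comp_apply]

/-- **S2′ FROM THE THREE SHAPES (generic)** — rows 7 (eigen class, `τ := ι⁻¹ ∘ χ`), 8 (`y ≠ 0` by the two injectivities) and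
9 (`y ∈ span(block)` by factoring the transport through `u₀`). -/
theorem s2prime_conclusion_of_shapes (h1 : BlockShape C ℓ X ι ρW) (h2 : CMQuotientShape E) (h3 : EigenClassShape E ℓ)
    (hne : ∃ f ∈ X.omegaHom ι ρW, ∃ w : W, f w ≠ 0) :
    ∃ (K : C5.SmallLevel C.S.K₀) (u : C.A K ⟶ C.A K) (a : ℕ), a ≠ 0 ∧ u ≫ u = a • u ∧
      ∃ (M : Type) (_ : Field M) (_ : NumberField M) (_ : IsCMField M) (i : M →+* (image u).endAlgebra),
        Module.finrank ℚ M = 2 * (image u).dim ∧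
        ∃ (τ : M →+* ℂ) (f : AlgebraicClosure ℚ_[ℓ] ⊗[ℚ_[ℓ]] Module.Dual ℚ_[ℓ] ((image u).rationalTateModule ℓ)),
          (∀ m : M, ((rationalTateAction (image u) ℓ (i m)).dualMap).baseChange (AlgebraicClosure ℚ_[ℓ]) f = ι (τ m) • f) ∧
          ((C.toTower ℓ K ∘ₗ (rationalTateModuleMap ℓ (toImage u)).dualMap).baseChange (AlgebraicClosure ℚ_[ℓ])) f ≠ 0 ∧
          ((C.toTower ℓ K ∘ₗ (rationalTateModuleMap ℓ (toImage u)).dualMap).baseChange (AlgebraicClosure ℚ_[ℓ])) f ∈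
            Submodule.span (AlgebraicClosure ℚ_[ℓ]) {y | ∃ f ∈ X.omegaHom ι ρW, ∃ w : W, f w = y} := by
  -- (H1): the block projector
  obtain ⟨K, u₀, a₀, ha₀, hu₀, hpos, hinj₀, hspan₀, R₀, hcomm, hred, hdeg⟩ := h1 hne
  -- (H2): the CM simple quotient factor
  haveI := hred
  obtain ⟨u, N, hN, hu, ψ, hψ, hψinj, M, _, _, _, j, -, hdim⟩ := h2 ℓ (C.A K) u₀ a₀ ha₀ hu₀ hpos R₀ hcomm hred hdeg
  -- (H3): an eigen class for `χ := ι ∘ τ`; choose any `χ : M → ℚ̄_ℓ` and put `τ := ι⁻¹ ∘ χ`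
  obtain ⟨χ⟩ : Nonempty (M →+* AlgebraicClosure ℚ_[ℓ]) := inferInstance
  obtain ⟨f, hf0, hf⟩ := h3 (image u) M j hdim χ
  refine ⟨K, u, N, hN, hu, M, inferInstance, inferInstance, inferInstance, j, hdim, (ι.symm : AlgebraicClosure ℚ_[ℓ] →+* ℂ).comp χ,
    f, fun m => ?_, ?_, ?_⟩
  · -- row 7
    rw [hf m]
    congr 1
    exact (ι.apply_symm_apply (χ m)).symm
  · -- row 8: `y ≠ 0`
    rw [transport_comp_eq C ℓ ψ hψ]
    intro h0
    exact hf0 (hψinj (hinj₀ (by rw [h0, map_zero, map_zero])))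
  · -- row 9: `y ∈ span(block)`
    rw [transport_comp_eq C ℓ ψ hψ]
    exact hspan₀ _

/-! ## v2 — (H3) is a THEOREM: ★ p748554 `TateModuleOfCMDualEigenclass` -/

/-- **(H3) `EigenClassShape` holds** for every number field `E` and prime `ℓ`:
★ `AbelianVariety.exists_ne_zero_dualMap_rationalTateAction_baseChange_eq_smul` (p748554), `(ℓ : E) ≠ 0`. -/
theorem eigenClassShape_holds (E : Type) [Field E] [NumberField E] (ℓ : ℕ) [Fact ℓ.Prime] :
    EigenClassShape E ℓ := by
  intro B M _ _ i hdim χ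
  have hℓ : (ℓ : E) ≠ 0 := Nat.cast_ne_zero.2 (Fact.out : ℓ.Prime).ne_zero
  exact AbelianVariety.exists_ne_zero_dualMap_rationalTateAction_baseChange_eq_smul hℓ i hdim _ χ

/-! ## v3 — the BLOCK-FIELD road (A-p09 (g13) referee flag 23:12:00Z + A-p11 analysis 23:20:44Z)

The «CM simple QUOTIENT» road ((H2) `CMQuotientShape`) cannot carry the class when the block field `R₀` is bigger than `End⁰` of
the simple factor (`[R₀ : M] = m > 1`): the pre-image of `span(blockValues)` under the injective, `Z`-equivariant `transport_{u₀}` is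
the `χ₀`-eigenline of `R₀`, which lies in the image of `ᵗV_ℓ(ψ)` for a simple quotient `ψ` only if `m = 1`.  v3 witnesses `S2′` by
`u := u₀` ITSELF, `M := R₀` (the block field, a number field of degree `2 dim (Im u₀)` mapping to `End⁰_E(Im u₀)`), `τ := τ₀` (the
label embedding), `f :=` a `(ι ∘ τ₀)`-eigen dual class (★ (E1) p748554, no simplicity), `IsCMField R₀` by ★ (T2) p749473
`isCMField_of_trace_mul_nonneg_over` (no simplicity) from a trace-non-negative ring endomorphism `ρ` of `R₀` («RosHecke»: the Rosati
involution of the canonical polarisation of `A_K` stabilises the Hecke image — `Rosati(T(KgK)) = T(Kg⁻¹K)` — and is positive,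
Mumford §21 Thm. 1; restricted to `R₀ = Z·e` for a Rosati-symmetric primitive block idempotent `e`). ONE live hypothesis. -/

-- `BlockShape'` is ★ `Summit.HodgeConjecture.CorCM.HypLiu418.S2prime.BlockShape'` (imported; same text as the v3 generic edition).

/-- **S2′ FROM THE BLOCK-FIELD SHAPE ALONE (v3, generic)** — `u := u₀`, `M := R₀`, `τ := τ₀`; row 7 by ★ (E1) `eigenClassShape_holds`,
row 8 by injectivity, row 9 by (4′), `IsCMField R₀` by ★ (T2) `isCMField_of_trace_mul_nonneg_over`. -/
theorem s2prime_conclusion_of_blockShape' (h1 : BlockShape' C ℓ X ι ρW) (hne : ∃ f ∈ X.omegaHom ι ρW, ∃ w : W, f w ≠ 0) :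
    ∃ (K : C5.SmallLevel C.S.K₀) (u : C.A K ⟶ C.A K) (a : ℕ), a ≠ 0 ∧ u ≫ u = a • u ∧
      ∃ (M : Type) (_ : Field M) (_ : NumberField M) (_ : IsCMField M) (i : M →+* (image u).endAlgebra),
        Module.finrank ℚ M = 2 * (image u).dim ∧
        ∃ (τ : M →+* ℂ) (f : AlgebraicClosure ℚ_[ℓ] ⊗[ℚ_[ℓ]] Module.Dual ℚ_[ℓ] ((image u).rationalTateModule ℓ)),
          (∀ m : M, ((rationalTateAction (image u) ℓ (i m)).dualMap).baseChange (AlgebraicClosure ℚ_[ℓ]) f = ι (τ m) • f) ∧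
          ((C.toTower ℓ K ∘ₗ (rationalTateModuleMap ℓ (toImage u)).dualMap).baseChange (AlgebraicClosure ℚ_[ℓ])) f ≠ 0 ∧
          ((C.toTower ℓ K ∘ₗ (rationalTateModuleMap ℓ (toImage u)).dualMap).baseChange (AlgebraicClosure ℚ_[ℓ])) f ∈
            Submodule.span (AlgebraicClosure ℚ_[ℓ]) {y | ∃ f ∈ X.omegaHom ι ρW, ∃ w : W, f w = y} := by
  obtain ⟨K, u₀, a₀, ha₀, hu₀, hpos, hinj₀, R₀, _, _, j, hdeg, ⟨ρ, hρ⟩, τ₀, hspan⟩ := h1 hne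
  -- `R₀` is a CM field: ★ (T2) over the subfield `E ⊆ ℂ` (any embedding)
  obtain ⟨σ⟩ : Nonempty (E →+* ℂ) := inferInstance
  letI : Algebra E ℂ := σ.toAlgebra
  have hCM : IsCMField R₀ :=
    Literature.AlgebraicGeometry.ComplexMultiplication.isCMField_of_trace_mul_nonneg_over j hdeg ρ hρ
  -- row 7: a non-zero `(ι ∘ τ₀)`-eigen dual class on `Im u₀` (★ (E1))
  obtain ⟨f, hf0, hf⟩ := eigenClassShape_holds E ℓ (image u₀) R₀ j hdeg ((ι : ℂ →+* AlgebraicClosure ℚ_[ℓ]).comp τ₀)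
  refine ⟨K, u₀, a₀, ha₀, hu₀, R₀, inferInstance, inferInstance, hCM, j, hdeg, τ₀, f, fun m => hf m, ?_, hspan f fun r => hf r⟩
  -- row 8: `y ≠ 0` by injectivity of the transport
  intro h0
  exact hf0 (hinj₀ (by rw [h0, map_zero]))

end Literature.NumberTheory.Automorphic.Liu2021.AppendixC.S2primeProbe

/-! ## S2′-BODY PROBE — Part B: instantiation at the registered binders (A-p11 (g11), by paste over v11 449e3d37) -/

open scoped TensorProduct Matrix NumberField Kronecker ComplexOrder
open NumberField NumberField.InfinitePlace IsDedekindDomain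
open Summit.HodgeConjecture.CorCM.Model Summit.HodgeConjecture.CorCM.Model.HComp Summit.HodgeConjecture.CorCM.HComp
open Literature.AlgebraicGeometry.Motives (CMType)
open Literature.AlgebraicGeometry.ShimuraVarieties.UnitaryCanonicalModel
open Literature.NumberTheory.Automorphic Literature.NumberTheory.Automorphic.UnitaryGroup
open Literature.NumberTheory.Automorphic.IdeleClassGroup Literature.NumberTheory.Automorphic.Liu2021 Literature.NumberTheory.Automorphic.Liu2021.AppendixC
open Literature.NumberTheory.GaloisRepresentations Literature.RepresentationTheory.Liu2021 Literature.RepresentationTheory.HarrisKudlaSweet1996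
open Literature.AlgebraicGeometry.Liu2021 (IsAdmissibleElement)
open Literature.NumberTheory.Weil1964 Literature.NumberTheory.GelbartRogawski1991 Literature.NumberTheory.GelbartRogawski1991.UnitaryDualPair Literature.NumberTheory.GelbartRogawski1991.UnitaryDualPair.WeilCoinv
open Literature.NumberTheory.GelbartRogawski1991.UnitaryDualPair.LocalSplitting
open Literature.NumberTheory.Automorphic.Liu2021.Def411WeilCarriersDoubling
open Literature.NumberTheory.Automorphic.Liu2021.Def411WeilCarriers (TW JW JW_eq isSymm_TW isUnit_det_TW Rep Eps epsOf Chi rhoVAtLine)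

namespace Summit.HodgeConjecture.CorCM.Lines.A3Liu418

open D6Glue
open CategoryTheory
open Literature.AlgebraicGeometry.Motives (AbelianVariety)

open Summit.HodgeConjecture.CorCM.HypLiu418.S2prime Literature.NumberTheory.Automorphic.Liu2021.AppendixC.S2primeProbe in
/-- **`S2primeShape` FROM THE THREE NAMED SHAPES** — (H1) the DH2c adaptor `BlockShape` at the registered datum (A-p09 + (G6) + S1/S1c + the
(ii)/(R-split) chain), (H2) the CM simple quotient factor `CMQuotientShape` (★ p745894 + residual (R2) + G-ros), (H3) the non-zero eigen dual
class `EigenClassShape` (★ TateModuleOfCM* + residual (E1)); rows 7–9 by `s2prime_conclusion_of_shapes`. -/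
theorem s2primeShape_of
    (h1 : ∀ (F : CMField) [IsGalois ℚ F] (ι₁ : F →+* ℂ)
    (μ : Literature.NumberTheory.Automorphic.IdeleClassGroup (F : Type) →ₜ* Circle)
    (hμ : IdeleClassGroup.IsConjugateSymplectic (F : Type) μ)
    (_hw : IdeleClassGroup.HasWeight (F : Type) μ 1)
    (ℓ : ℕ) [Fact ℓ.Prime] (ι' : ℂ ≃+* AlgebraicClosure ℚ_[ℓ])
    (Jstar : Matrix (Fin 2) (Fin 2) (F : Type)) (t : (F : Type)) (ht : t ≠ 0) (_hτt : 0 < (ι₁ t).re) (_hτt' : (ι₁ t).im = 0)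
    (gstar : GL (Fin 2) (F : Type))
    (dJ : Fin 2 → (F : Type)) (hdJ : ∀ i, IsCMField.complexConj (F : Type) (dJ i) = dJ i) (hdJ0 : ∀ i, dJ i ≠ 0)
    (hg : formCongr ((IsCMField.complexConj (F : Type) : (F : Type) ≃ₐ[↥(maximalRealSubfield (F : Type))] (F : Type)) :
        (F : Type) →+* (F : Type)) gstar (t • Jstar) = Matrix.diagonal dJ)
    (_hsig : (∃ Tstar : GL (Fin 2) ℂ,
        formCongr (starRingEnd ℂ) Tstar ((Matrix.diagonal dJ).map ι₁) = Matrix.diagonal ![(1 : ℂ), -1]) ∧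
      ∀ τ' : (F : Type) →+* ℂ, InfinitePlace.mk τ' ≠ InfinitePlace.mk ι₁ → ((Matrix.diagonal dJ).map τ').PosDef)
    (K₀ : C5.OpenCompactSubgroup ↥(finAdelic ↥(maximalRealSubfield (F : Type)) (F : Type) (IsCMField.complexConj (F : Type)) 2 Jstar))
    (S : RecordSystemGS (F : Type) Jstar ι₁ K₀) (hU7ₛ : S.HeckeTranslateDefinedOver) (hLQ : S.IsLevelQuotient)
    (h4 : 4 ≤ Module.finrank ℚ (F : Type)) (isoₛ : ℕ → Prop)
    (r : Rep ↥(maximalRealSubfield (F : Type)) (imagUnitSq F))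
    (ε : Eps ↥(maximalRealSubfield (F : Type)) (imagUnitSq F))
    (_hadm : ∃ e : (F : Type), IsAdmissibleElement (F : Type) hμ.cmType.1 e ∧
      epsOf ↥(maximalRealSubfield (F : Type)) (imagUnitSq F) (F : Type) (2 * imagUnit (F : Type))⁻¹ (-e) = ε)
    (χ : Chi ↥(maximalRealSubfield (F : Type)) (F : Type) (IsCMField.complexConj (F : Type))),
      BlockShape (sec42DataGS S h4 isoₛ) ℓ (etaleHeckeDatumGS S hU7ₛ hLQ h4 isoₛ ℓ) ι'
        ((rhoVAtLine ↥(maximalRealSubfield (F : Type)) (F : Type) (IsCMField.complexConj (F : Type)) 2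
          (finProdFinEquiv : Fin 2 × Fin 1 ≃ Fin (2 * 1)) (Matrix.diagonal dJ)
          (complexConj_imagUnit F) (imagUnit_ne_zero F) (imagUnit_mul_self F) (realDiagonal_isSymm F dJ hdJ)
          (isUnit_det_realDiagonal F dJ hdJ hdJ0) (realDiagonal_map F dJ hdJ).symm
          (hsChiGS F finProdFinEquiv dJ hdJ hdJ0
            (toHeckeCharacter (F : Type) (galConj (IsCMField.complexConj (F : Type)) μ))
            (isUnitary_toHeckeCharacter (F : Type) (galConj (IsCMField.complexConj (F : Type)) μ))
            ((isOscillatorChar_toHeckeCharacter_iff (galConj (IsCMField.complexConj (F : Type)) μ)).mpr hμ.galConj))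
          (r.toFun ε) χ).comp
          (finAdelicCongr ↥(maximalRealSubfield (F : Type)) (F : Type) (IsCMField.complexConj (F : Type)) gstar ht hg).symm.toMonoidHom))
    (h2 : ∀ (F : CMField), CMQuotientShape (F : Type))
    (h3 : ∀ (F : CMField) (ℓ : ℕ) [Fact ℓ.Prime], EigenClassShape (F : Type) ℓ) : S2primeShape := by
  intro F _ ι₁ μ hμ hw ℓ _ ι' Jstar t ht hτt hτt' gstar dJ hdJ hdJ0 hg hsig K₀ S hU7ₛ hLQ h4 isoₛ r ε hadm χ hne
  exact s2prime_conclusion_of_shapes _ ℓ _ ι' _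
    (h1 F ι₁ μ hμ hw ℓ ι' Jstar t ht hτt hτt' gstar dJ hdJ hdJ0 hg hsig K₀ S hU7ₛ hLQ h4 isoₛ r ε hadm χ) (h2 F) (h3 F ℓ) hne


open Summit.HodgeConjecture.CorCM.HypLiu418.S2prime Literature.NumberTheory.Automorphic.Liu2021.AppendixC.S2primeProbe in
/-- **v2: `S2primeShape` from the TWO live shapes** — (H1) `BlockShape` (DH2c adaptor, A-p09) and (H2)
`CMQuotientShape` (★ p745894 + ★ (R2) p749323 + ★ (T2) p749473 + RosPos-k); (H3) discharged by
`eigenClassShape_holds` (★ p748554). -/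
theorem s2primeShape_of'
    (h1 : ∀ (F : CMField) [IsGalois ℚ F] (ι₁ : F →+* ℂ)
    (μ : Literature.NumberTheory.Automorphic.IdeleClassGroup (F : Type) →ₜ* Circle)
    (hμ : IdeleClassGroup.IsConjugateSymplectic (F : Type) μ)
    (_hw : IdeleClassGroup.HasWeight (F : Type) μ 1)
    (ℓ : ℕ) [Fact ℓ.Prime] (ι' : ℂ ≃+* AlgebraicClosure ℚ_[ℓ])
    (Jstar : Matrix (Fin 2) (Fin 2) (F : Type)) (t : (F : Type)) (ht : t ≠ 0) (_hτt : 0 < (ι₁ t).re) (_hτt' : (ι₁ t).im = 0)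
    (gstar : GL (Fin 2) (F : Type))
    (dJ : Fin 2 → (F : Type)) (hdJ : ∀ i, IsCMField.complexConj (F : Type) (dJ i) = dJ i) (hdJ0 : ∀ i, dJ i ≠ 0)
    (hg : formCongr ((IsCMField.complexConj (F : Type) : (F : Type) ≃ₐ[↥(maximalRealSubfield (F : Type))] (F : Type)) :
        (F : Type) →+* (F : Type)) gstar (t • Jstar) = Matrix.diagonal dJ)
    (_hsig : (∃ Tstar : GL (Fin 2) ℂ,
        formCongr (starRingEnd ℂ) Tstar ((Matrix.diagonal dJ).map ι₁) = Matrix.diagonal ![(1 : ℂ), -1]) ∧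
      ∀ τ' : (F : Type) →+* ℂ, InfinitePlace.mk τ' ≠ InfinitePlace.mk ι₁ → ((Matrix.diagonal dJ).map τ').PosDef)
    (K₀ : C5.OpenCompactSubgroup ↥(finAdelic ↥(maximalRealSubfield (F : Type)) (F : Type) (IsCMField.complexConj (F : Type)) 2 Jstar))
    (S : RecordSystemGS (F : Type) Jstar ι₁ K₀) (hU7ₛ : S.HeckeTranslateDefinedOver) (hLQ : S.IsLevelQuotient)
    (h4 : 4 ≤ Module.finrank ℚ (F : Type)) (isoₛ : ℕ → Prop)
    (r : Rep ↥(maximalRealSubfield (F : Type)) (imagUnitSq F))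
    (ε : Eps ↥(maximalRealSubfield (F : Type)) (imagUnitSq F))
    (_hadm : ∃ e : (F : Type), IsAdmissibleElement (F : Type) hμ.cmType.1 e ∧
      epsOf ↥(maximalRealSubfield (F : Type)) (imagUnitSq F) (F : Type) (2 * imagUnit (F : Type))⁻¹ (-e) = ε)
    (χ : Chi ↥(maximalRealSubfield (F : Type)) (F : Type) (IsCMField.complexConj (F : Type))),
      BlockShape (sec42DataGS S h4 isoₛ) ℓ (etaleHeckeDatumGS S hU7ₛ hLQ h4 isoₛ ℓ) ι'
        ((rhoVAtLine ↥(maximalRealSubfield (F : Type)) (F : Type) (IsCMField.complexConj (F : Type)) 2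
          (finProdFinEquiv : Fin 2 × Fin 1 ≃ Fin (2 * 1)) (Matrix.diagonal dJ)
          (complexConj_imagUnit F) (imagUnit_ne_zero F) (imagUnit_mul_self F) (realDiagonal_isSymm F dJ hdJ)
          (isUnit_det_realDiagonal F dJ hdJ hdJ0) (realDiagonal_map F dJ hdJ).symm
          (hsChiGS F finProdFinEquiv dJ hdJ hdJ0
            (toHeckeCharacter (F : Type) (galConj (IsCMField.complexConj (F : Type)) μ))
            (isUnitary_toHeckeCharacter (F : Type) (galConj (IsCMField.complexConj (F : Type)) μ))
            ((isOscillatorChar_toHeckeCharacter_iff (galConj (IsCMField.complexConj (F : Type)) μ)).mpr hμ.galConj))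
          (r.toFun ε) χ).comp
          (finAdelicCongr ↥(maximalRealSubfield (F : Type)) (F : Type) (IsCMField.complexConj (F : Type)) gstar ht hg).symm.toMonoidHom))
    (h2 : ∀ (F : CMField), CMQuotientShape (F : Type)) : S2primeShape :=
  s2primeShape_of h1 h2 (fun F ℓ _ => eigenClassShape_holds (F : Type) ℓ)


open Summit.HodgeConjecture.CorCM.HypLiu418.S2prime Literature.NumberTheory.Automorphic.Liu2021.AppendixC.S2primeProbe in
/-- **v3: `S2primeShape` from the ONE live shape (H1′) `BlockShape'`** (block-field road: `u := u₀`, `M := R₀`; ★ (E1) p748554 and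
★ (T2) p749473 by name; (H2)/(H3) have left the skeleton). -/
theorem s2primeShape_of''
    (h1 : ∀ (F : CMField) [IsGalois ℚ F] (ι₁ : F →+* ℂ)
    (μ : Literature.NumberTheory.Automorphic.IdeleClassGroup (F : Type) →ₜ* Circle)
    (hμ : IdeleClassGroup.IsConjugateSymplectic (F : Type) μ)
    (_hw : IdeleClassGroup.HasWeight (F : Type) μ 1)
    (ℓ : ℕ) [Fact ℓ.Prime] (ι' : ℂ ≃+* AlgebraicClosure ℚ_[ℓ])
    (Jstar : Matrix (Fin 2) (Fin 2) (F : Type)) (t : (F : Type)) (ht : t ≠ 0) (_hτt : 0 < (ι₁ t).re) (_hτt' : (ι₁ t).im = 0)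
    (gstar : GL (Fin 2) (F : Type))
    (dJ : Fin 2 → (F : Type)) (hdJ : ∀ i, IsCMField.complexConj (F : Type) (dJ i) = dJ i) (hdJ0 : ∀ i, dJ i ≠ 0)
    (hg : formCongr ((IsCMField.complexConj (F : Type) : (F : Type) ≃ₐ[↥(maximalRealSubfield (F : Type))] (F : Type)) :
        (F : Type) →+* (F : Type)) gstar (t • Jstar) = Matrix.diagonal dJ)
    (_hsig : (∃ Tstar : GL (Fin 2) ℂ,
        formCongr (starRingEnd ℂ) Tstar ((Matrix.diagonal dJ).map ι₁) = Matrix.diagonal ![(1 : ℂ), -1]) ∧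
      ∀ τ' : (F : Type) →+* ℂ, InfinitePlace.mk τ' ≠ InfinitePlace.mk ι₁ → ((Matrix.diagonal dJ).map τ').PosDef)
    (K₀ : C5.OpenCompactSubgroup ↥(finAdelic ↥(maximalRealSubfield (F : Type)) (F : Type) (IsCMField.complexConj (F : Type)) 2 Jstar))
    (S : RecordSystemGS (F : Type) Jstar ι₁ K₀) (hU7ₛ : S.HeckeTranslateDefinedOver) (hLQ : S.IsLevelQuotient)
    (h4 : 4 ≤ Module.finrank ℚ (F : Type)) (isoₛ : ℕ → Prop)
    (r : Rep ↥(maximalRealSubfield (F : Type)) (imagUnitSq F))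
    (ε : Eps ↥(maximalRealSubfield (F : Type)) (imagUnitSq F))
    (_hadm : ∃ e : (F : Type), IsAdmissibleElement (F : Type) hμ.cmType.1 e ∧
      epsOf ↥(maximalRealSubfield (F : Type)) (imagUnitSq F) (F : Type) (2 * imagUnit (F : Type))⁻¹ (-e) = ε)
    (χ : Chi ↥(maximalRealSubfield (F : Type)) (F : Type) (IsCMField.complexConj (F : Type))),
      BlockShape' (sec42DataGS S h4 isoₛ) ℓ (etaleHeckeDatumGS S hU7ₛ hLQ h4 isoₛ ℓ) ι'
        ((rhoVAtLine ↥(maximalRealSubfield (F : Type)) (F : Type) (IsCMField.complexConj (F : Type)) 2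
          (finProdFinEquiv : Fin 2 × Fin 1 ≃ Fin (2 * 1)) (Matrix.diagonal dJ)
          (complexConj_imagUnit F) (imagUnit_ne_zero F) (imagUnit_mul_self F) (realDiagonal_isSymm F dJ hdJ)
          (isUnit_det_realDiagonal F dJ hdJ hdJ0) (realDiagonal_map F dJ hdJ).symm
          (hsChiGS F finProdFinEquiv dJ hdJ hdJ0
            (toHeckeCharacter (F : Type) (galConj (IsCMField.complexConj (F : Type)) μ))
            (isUnitary_toHeckeCharacter (F : Type) (galConj (IsCMField.complexConj (F : Type)) μ))
            ((isOscillatorChar_toHeckeCharacter_iff (galConj (IsCMField.complexConj (F : Type)) μ)).mpr hμ.galConj))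
          (r.toFun ε) χ).comp
          (finAdelicCongr ↥(maximalRealSubfield (F : Type)) (F : Type) (IsCMField.complexConj (F : Type)) gstar ht hg).symm.toMonoidHom)) : S2primeShape := by
  intro F _ ι₁ μ hμ hw ℓ _ ι' Jstar t ht hτt hτt' gstar dJ hdJ hdJ0 hg hsig K₀ S hU7ₛ hLQ h4 isoₛ r ε hadm χ hne
  exact s2prime_conclusion_of_blockShape' _ ℓ _ ι' _ (h1 F ι₁ μ hμ hw ℓ ι' Jstar t ht hτt hτt' gstar dJ hdJ hdJ0 hg hsig K₀ S hU7ₛ hLQ h4 isoₛ r ε hadm χ) hne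

end Summit.HodgeConjecture.CorCM.Lines.A3Liu418

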